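import Mathlib.Data.ZMod.Basic
import Mathlib.Algebra.BigOperators.Ring.Finset
import Mathlib.Logic.Relation
import Mathlib.LinearAlgebra.UnitaryGroup
import Literature.Probability.LatticeModels.LatticeGraph
import HarnessLib

/-!
# `RigorousRGSmallParameter` (Slade, Theorem 1.4.1): blocks, polymers, the circle product,
# connected components, small sets, `X^□`, and the space `𝒦_j` (Slade §6.1)

Companion ("proof architecture") file of
`Literature/Barriers/CriticalPhenomena/RigorousRGSmallParameter.lean`. The tree reduces that
barrier to the named fact `LongRangePhi4.Slade2017_prop822`, the output of the renormalisation
group; its single step is Slade's Theorem 6.3.1, a statement about maps on the space `𝒦_j` of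
polymer activities in the representation `Z_j = e^{-u_j|Λ|}(I_j ∘ K_j)(Λ)` of his §6.1. This file
formalises the combinatorial vocabulary of that section (all of it elementary; everything is
proved, no named fact is introduced):

Source: G. Slade, Commun. Math. Phys. **358** (2018) 343–436, arXiv:1611.06169, §6.1
"Nonperturbative coordinate" (read from the TeX source), which recalls [BS-rg-step] §1.1;
for `X ⊂ X^□`, `(X∪Y)^□ = X^□ ∪ Y^□`: D. Brydges, G. Slade, J. Stat. Phys. 159 (2015) 421–460,
Definition 3.7.1 [BS-rg-norm].

* Blocks: "the torus `Λ_N` partitions into `L^{N-j}` disjoint `d`-dimensional cubes of side `L^j` …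
  The block that contains the origin is `{x ∈ Λ : 0 ≤ x_i < L^j}`, and other blocks are translates
  of this one by vectors in `L^jℤ^d`" — on the torus `(ℤ/Mℤ)^d` (`TorusSite d M`, for Slade
  `M = L^N`) the block of `x` at side `b = L^j` is the set of `y` with `⌊y_i/b⌋ = ⌊x_i/b⌋`
  (representatives in `{0,…,M-1}`): `blockKey`, `block` (equal or disjoint: `block_eq_of_mem`).
* Polymers `𝒫_j` ("a union of `j`-blocks (possibly empty)"): `IsPolymer` (closed under
  `∪, ∩, ∖, ᶜ`), `blocksOf` (`ℬ_j(X)`), `numBlocks` (`|X|_j`), `subpolymers`.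
* The circle product "`(F_1 ∘ F_2)(Y) = Σ_{X ∈ 𝒫_j : X ⊂ Y} F_1(X)F_2(Y∖X)` … The terms
  corresponding to `X = ∅` and `X = Y` are included … The circle product is associative and
  commutative … The identity element is `𝟙_∅`": `circ`, `unitP`, **`circ_comm`**, **`circ_assoc`**,
  `circ_unitP`, `unitP_circ`; and at the last scale ("the unique `N`-block is `Λ_N` itself"; "the
  only polymers at scale `N` are `∅, Λ`", proof of Proposition 8.2.2): `block_eq_univ_of_le`,
  `isPolymer_iff_of_le`, `circ_univ_of_le` (`(F∘G)(Λ) = F(Λ) + G(Λ)` when `F(∅) = G(∅) = 1`, i.e.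
  `Z_N = e^{-u_N|Λ|}(I_N(Λ) + K_N(Λ))`).
* `𝒩(X)` ("elements of `𝒩` which depend on the values of `φ_x` only for `x ∈ X`"): `DependsOn`
  with its algebra.
* Connectedness ("for any `x, x' ∈ X` there exist `x_0,…,x_n ∈ X` with `|x_{i+1}-x_i|_∞ = 1`"),
  `Comp_j(X)`: `AdjInf`, `ConnIn`, `IsConn`, `comp`, `components` (a partition into connected
  sets: `eq_biUnion_components`, `comp_disjoint_or_eq`, `isConn_comp`); **`connIn_block`** (blocks
  are connected — monotone coordinate paths between representatives), hence the components of a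
  polymer are polymers (`IsPolymer.comp`).
* Small sets ("a connected polymer `X ∈ 𝒫_j` consisting of at most `2^d` blocks") and
  "`X^□ = ⋃_{Y ∈ 𝒮_j : X ∩ Y ≠ ∅} Y`": `IsSmall`, `sclosure`, `subset_sclosure`, `sclosure_union`,
  `isPolymer_sclosure`, `sclosure_mono`.
* **Definition 6.1.2** (`𝒦_j`, `n ≥ 1`): `KSpace` — an activity `K` with `K(∅) = 1`, field
  locality `K(X) ∈ 𝒩(X^□)`, component factorisation, `O(n)` invariance and Euclidean covariance
  under scale-`j` automorphisms (`IsScaleAut`); `KSpace.unit` (`K_0 = 𝟙_∅`).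

Not treated here: `I_j(V,X) = e^{-V(X)}∏_B(1+W_j(V,B))` (needs the localisation operator of §4.2 /
[BS-rg-loc]) and the norms of §6.2 (sibling files `RigorousRGSmallParameterTphi*.lean`,
`…TestFunctionNorm.lean`). Ledger effect: none on the trust base of the barrier's reduction chain
(`Slade2017_prop822`).
-/

noncomputable section

open Finset

namespace Literature.Barriers.CriticalPhenomena

namespace LongRangePhi4

namespace Polymer

open Literature.Probability.LatticeModels

variable {d M : ℕ}

/-! ### Blocks of side `b` on the torus `(ℤ/Mℤ)^d` -/

/-- The block coordinates of a site: `⌊x_i / b⌋` for the representative `x_i ∈ {0,…,M-1}`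
("The block that contains the origin is `{x ∈ Λ : 0 ≤ x_i < L^j}`, and other blocks are
translates of this one by vectors in `L^jℤ^d`"; here `b = L^j`). [cite: Slade2017, §6.1 (first paragraph)] -/
def blockKey (b : ℕ) (x : TorusSite d M) : Fin d → ℕ := fun i => (x i).val / b

/-! ### Field locality: `𝒩(X)` -/

/-- `𝒩(X)`: the function `F` of the field depends only on `φ_x`, `x ∈ X` ("the set of elements of
`𝒩` (functions of `φ`) which depend on the values of `φ_x` only for `x ∈ X`").
[cite: Slade2017, §6.1 (definition of 𝒩(X))] -/
def DependsOn {V R : Type*} (X : Finset (TorusSite d M)) (F : (TorusSite d M → V) → R) : Prop :=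
  ∀ φ ψ : TorusSite d M → V, (∀ x ∈ X, φ x = ψ x) → F φ = F ψ

/-- `𝒩(X) ⊆ 𝒩(X')` for `X ⊆ X'`. [folklore] -/
theorem DependsOn.mono {V R : Type*} {X X' : Finset (TorusSite d M)} {F : (TorusSite d M → V) → R}
    (h : DependsOn X F) (hXX' : X ⊆ X') : DependsOn X' F :=
  fun φ ψ hφψ => h φ ψ fun x hx => hφψ x (hXX' hx)

/-- Constants are in `𝒩(∅)`. [folklore] -/
theorem dependsOn_const {V R : Type*} (X : Finset (TorusSite d M)) (c : R) :
    DependsOn X (fun _ : TorusSite d M → V => c) := fun _ _ _ => rfl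

/-- `𝒩(X)` is closed under products. [folklore] -/
theorem DependsOn.mul {V R : Type*} [Mul R] {X : Finset (TorusSite d M)} {F G : (TorusSite d M → V) → R}
    (hF : DependsOn X F) (hG : DependsOn X G) : DependsOn X (fun φ => F φ * G φ) :=
  fun φ ψ h => by simp only [hF φ ψ h, hG φ ψ h]

/-- `𝒩(X)` is closed under sums. [folklore] -/
theorem DependsOn.add {V R : Type*} [Add R] {X : Finset (TorusSite d M)} {F G : (TorusSite d M → V) → R}
    (hF : DependsOn X F) (hG : DependsOn X G) : DependsOn X (fun φ => F φ + G φ) :=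
  fun φ ψ h => by simp only [hF φ ψ h, hG φ ψ h]

/-- `𝒩(X)` is closed under finite products. [folklore] -/
theorem DependsOn.prod {V R : Type*} [CommMonoid R] {β : Type*} {s : Finset β} {X : Finset (TorusSite d M)}
    {F : β → (TorusSite d M → V) → R} (h : ∀ k ∈ s, DependsOn X (F k)) :
    DependsOn X (fun φ => ∏ k ∈ s, F k φ) :=
  fun φ ψ hφψ => Finset.prod_congr rfl fun k hk => h k hk φ ψ hφψ

/-- `𝒩(X)` is closed under finite sums. [folklore] -/
theorem DependsOn.sum {V R : Type*} [AddCommMonoid R] {β : Type*} {s : Finset β} {X : Finset (TorusSite d M)}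
    {F : β → (TorusSite d M → V) → R} (h : ∀ k ∈ s, DependsOn X (F k)) :
    DependsOn X (fun φ => ∑ k ∈ s, F k φ) :=
  fun φ ψ hφψ => Finset.sum_congr rfl fun k hk => h k hk φ ψ hφψ

/-- Everything is in `𝒩(Λ)`. [folklore] -/
theorem dependsOn_univ [NeZero M] {V R : Type*} (F : (TorusSite d M → V) → R) : DependsOn univ F :=
  fun φ ψ h => by rw [show φ = ψ from funext fun x => h x (mem_univ x)]

/-- Post-composition preserves `𝒩(X)`. [folklore] -/
theorem DependsOn.comp {V R R' : Type*} {X : Finset (TorusSite d M)} {F : (TorusSite d M → V) → R}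
    (hF : DependsOn X F) (f : R → R') : DependsOn X (fun φ => f (F φ)) :=
  fun φ ψ h => by simp only [hF φ ψ h]

/-! ### `ℓ^∞`-connectedness, connected components -/

/-- `|x - y|_∞ = 1` on the torus: distinct sites all of whose coordinates differ by `0` or `±1`. [cite: Slade2017, §6.1 (definition of connected sets: |x_{i+1} - x_i|_∞ = 1)] -/
def AdjInf (x y : TorusSite d M) : Prop := x ≠ y ∧ ∀ i, y i = x i ∨ y i = x i + 1 ∨ x i = y i + 1

/-- `AdjInf` is symmetric. [folklore] -/
theorem AdjInf.symm {x y : TorusSite d M} (h : AdjInf x y) : AdjInf y x := by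
  refine ⟨h.1.symm, fun i => ?_⟩
  rcases h.2 i with h' | h' | h'
  · exact Or.inl h'.symm
  · exact Or.inr (Or.inr h')
  · exact Or.inr (Or.inl h')

/-- Joined inside `X` by an `ℓ^∞`-path ("there exist `x_0, …, x_n ∈ X` with `|x_{i+1}-x_i|_∞ = 1`,
`x_0 = x` and `x_n = x'`"). [cite: Slade2017, §6.1 (definition of connected sets)] -/
def ConnIn (X : Finset (TorusSite d M)) : TorusSite d M → TorusSite d M → Prop :=
  Relation.ReflTransGen fun a c => a ∈ X ∧ c ∈ X ∧ AdjInf a c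

/-- A connected set: nonempty, any two points joined inside it. [cite: Slade2017, §6.1 (definition of connected sets)] -/
def IsConn (X : Finset (TorusSite d M)) : Prop := X.Nonempty ∧ ∀ x ∈ X, ∀ y ∈ X, ConnIn X x y

/-- `ConnIn X` is symmetric. [folklore] -/
theorem ConnIn.symm {X : Finset (TorusSite d M)} {x y : TorusSite d M} (h : ConnIn X x y) : ConnIn X y x := by
  unfold ConnIn at *
  induction h with
  | refl => exact Relation.ReflTransGen.refl
  | tail _ hbc ih => exact Relation.ReflTransGen.head ⟨hbc.2.1, hbc.1, hbc.2.2.symm⟩ ih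

/-- `ConnIn X` is transitive. [folklore] -/
theorem ConnIn.trans {X : Finset (TorusSite d M)} {x y z : TorusSite d M} (h : ConnIn X x y) (h' : ConnIn X y z) :
    ConnIn X x z :=
  Relation.ReflTransGen.trans h h'

/-- Paths inside `X` are paths inside any `X' ⊇ X`. [folklore] -/
theorem ConnIn.mono {X X' : Finset (TorusSite d M)} (hXX' : X ⊆ X') {x y : TorusSite d M} (h : ConnIn X x y) :
    ConnIn X' x y := by
  unfold ConnIn at *
  induction h with
  | refl => exact Relation.ReflTransGen.refl
  | tail _ hbc ih => exact ih.tail ⟨hXX' hbc.1, hXX' hbc.2.1, hbc.2.2⟩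

/-- The endpoint of a nontrivial path inside `X` lies in `X`. [folklore] -/
theorem ConnIn.mem_of_ne {X : Finset (TorusSite d M)} {x y : TorusSite d M} (h : ConnIn X x y) (hxy : x ≠ y) : y ∈ X := by
  unfold ConnIn at h
  induction h with
  | refl => exact absurd rfl hxy
  | tail _ hbc _ => exact hbc.2.1

open Classical in
/-- The connected component of `x` in `X` (empty if `x ∉ X`). [cite: Slade2017, §6.1 ("Comp_j(X) … the set of connected components of X")] -/
def comp (X : Finset (TorusSite d M)) (x : TorusSite d M) : Finset (TorusSite d M) := X.filter fun y => ConnIn X x y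

/-- The set `Comp(X)` of connected components of `X`. [cite: Slade2017, §6.1 (Comp_j(X))] -/
def components (X : Finset (TorusSite d M)) : Finset (Finset (TorusSite d M)) :=
  X.image (comp X)

/-- Membership in a component. [folklore] -/
theorem mem_comp {X : Finset (TorusSite d M)} {x y : TorusSite d M} : y ∈ comp X x ↔ y ∈ X ∧ ConnIn X x y := by
  classical
  simp [comp]

/-- Components are subsets. [folklore] -/
theorem comp_subset (X : Finset (TorusSite d M)) (x : TorusSite d M) : comp X x ⊆ X := fun _ hy => (mem_comp.1 hy).1

/-- `x ∈ Comp_x` for `x ∈ X`. [folklore] -/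
theorem mem_comp_self {X : Finset (TorusSite d M)} {x : TorusSite d M} (hx : x ∈ X) : x ∈ comp X x :=
  mem_comp.2 ⟨hx, Relation.ReflTransGen.refl⟩

/-- Points of a component have the same component. [folklore] -/
theorem comp_eq_of_mem {X : Finset (TorusSite d M)} {x y : TorusSite d M} (hy : y ∈ comp X x) : comp X y = comp X x := by
  obtain ⟨_, hxy⟩ := mem_comp.1 hy
  ext z
  simp only [mem_comp]
  exact ⟨fun ⟨hz, hyz⟩ => ⟨hz, hxy.trans hyz⟩, fun ⟨hz, hxz⟩ => ⟨hz, hxy.symm.trans hxz⟩⟩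

/-- A set is the union of its components. [folklore] -/
theorem eq_biUnion_components (X : Finset (TorusSite d M)) : X = (components X).biUnion id := by
  ext y
  simp only [components, mem_biUnion, mem_image, id_eq]
  constructor
  · intro hy; exact ⟨comp X y, ⟨y, hy, rfl⟩, mem_comp_self hy⟩
  · rintro ⟨_, ⟨x, _, rfl⟩, hy⟩; exact comp_subset X x hy

/-- Distinct components are disjoint. [folklore] -/
theorem comp_disjoint_or_eq (X : Finset (TorusSite d M)) (x x' : TorusSite d M) :
    comp X x = comp X x' ∨ Disjoint (comp X x) (comp X x') := by
  by_cases h : Disjoint (comp X x) (comp X x')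
  · exact Or.inr h
  · left
    rw [not_disjoint_iff] at h
    obtain ⟨y, hy, hy'⟩ := h
    rw [← comp_eq_of_mem hy, comp_eq_of_mem hy']

/-- A path inside `X` starting at `x` stays inside the component of `x`. [folklore] -/
theorem ConnIn.connIn_comp {X : Finset (TorusSite d M)} {x y : TorusSite d M} (h : ConnIn X x y) :
    ConnIn (comp X x) x y := by
  unfold ConnIn at h ⊢
  induction h with
  | refl => exact Relation.ReflTransGen.refl
  | tail hab hbc ih =>
    refine Relation.ReflTransGen.tail ih ⟨?_, ?_, hbc.2.2⟩
    · exact mem_comp.2 ⟨hbc.1, hab⟩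
    · exact mem_comp.2 ⟨hbc.2.1, Relation.ReflTransGen.tail hab hbc⟩

/-- **Components are connected.** [folklore] -/
theorem isConn_comp {X : Finset (TorusSite d M)} {x : TorusSite d M} (hx : x ∈ X) : IsConn (comp X x) := by
  refine ⟨⟨x, mem_comp_self hx⟩, fun y hy z hz => ?_⟩
  obtain ⟨_, hxy⟩ := mem_comp.1 hy
  obtain ⟨_, hxz⟩ := mem_comp.1 hz
  exact hxy.connIn_comp.symm.trans hxz.connIn_comp

/-- A connected set is a single component. [folklore] -/
theorem IsConn.comp_eq {X : Finset (TorusSite d M)} (hX : IsConn X) {x : TorusSite d M} (hx : x ∈ X) : comp X x = X := by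
  ext y
  simp only [mem_comp]
  exact ⟨fun h => h.1, fun hy => ⟨hy, hX.2 x hx y hy⟩⟩

/-- A connected set has exactly one component. [folklore] -/
theorem IsConn.components_eq {X : Finset (TorusSite d M)} (hX : IsConn X) : components X = {X} := by
  ext Y
  simp only [components, mem_image, mem_singleton]
  constructor
  · rintro ⟨x, hx, rfl⟩; exact hX.comp_eq hx
  · rintro rfl
    obtain ⟨x, hx⟩ := hX.1
    exact ⟨x, hx, hX.comp_eq hx⟩

variable [NeZero M]

/-- The `b`-block containing `x` (a cube of side `b`; `j`-blocks are the case `b = L^j`).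
[cite: Slade2017, §6.1 (definition of blocks / j-blocks)] -/
def block (b : ℕ) (x : TorusSite d M) : Finset (TorusSite d M) :=
  univ.filter fun y => blockKey b y = blockKey b x

/-- Membership in a block is equality of block coordinates. [folklore] -/
@[simp] theorem mem_block {b : ℕ} {x y : TorusSite d M} : y ∈ block b x ↔ blockKey b y = blockKey b x := by
  simp [block]

/-- `x ∈ B_x`. [folklore] -/
theorem mem_block_self (b : ℕ) (x : TorusSite d M) : x ∈ block b x := by simp

/-- Two blocks are equal or disjoint: `y ∈ B_x ↔ B_y = B_x`. [folklore] -/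
theorem block_eq_of_mem {b : ℕ} {x y : TorusSite d M} (h : y ∈ block b x) : block b y = block b x := by
  ext z
  rw [mem_block] at h
  simp [h]

/-- A point of a block determines it. [folklore] -/
theorem block_eq_block_iff {b : ℕ} {x y : TorusSite d M} : block b y = block b x ↔ y ∈ block b x :=
  ⟨fun h => h ▸ mem_block_self b y, block_eq_of_mem⟩

/-! ### Polymers -/

/-- A `b`-polymer: a union of `b`-blocks ("A union of `j`-blocks (possibly empty) is called a
polymer or `j`-polymer"). [cite: Slade2017, §6.1 (definition of polymers)] -/
def IsPolymer (b : ℕ) (X : Finset (TorusSite d M)) : Prop :=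
  ∀ ⦃x⦄, x ∈ X → block b x ⊆ X

/-- The empty set is a polymer. [cite: Slade2017, §6.1 ("possibly empty")] -/
theorem isPolymer_empty (b : ℕ) : IsPolymer b (∅ : Finset (TorusSite d M)) := fun x hx => by simp at hx

/-- The whole torus is a polymer ("The unique `N`-block is `Λ_N` itself"). [cite: Slade2017, §6.1] -/
theorem isPolymer_univ (b : ℕ) : IsPolymer b (univ : Finset (TorusSite d M)) := fun _ _ => subset_univ _

/-- A block is a polymer. [folklore] -/
theorem isPolymer_block (b : ℕ) (x : TorusSite d M) : IsPolymer b (block b x) := by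
  intro y hy
  rw [block_eq_of_mem hy]

/-- Unions of polymers are polymers. [folklore] -/
theorem IsPolymer.union {b : ℕ} {X Y : Finset (TorusSite d M)} (hX : IsPolymer b X) (hY : IsPolymer b Y) :
    IsPolymer b (X ∪ Y) := by
  intro x hx
  rcases mem_union.1 hx with h | h
  · exact (hX h).trans subset_union_left
  · exact (hY h).trans subset_union_right

/-- Complements of polymers are polymers. [folklore] -/
theorem IsPolymer.compl {b : ℕ} {X : Finset (TorusSite d M)} (hX : IsPolymer b X) : IsPolymer b Xᶜ := by
  intro x hx y hy
  rw [mem_compl] at hx ⊢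
  intro hyX
  exact hx (hX hyX (by rw [block_eq_of_mem hy]; exact mem_block_self b x))

/-- Intersections of polymers are polymers. [folklore] -/
theorem IsPolymer.inter {b : ℕ} {X Y : Finset (TorusSite d M)} (hX : IsPolymer b X) (hY : IsPolymer b Y) :
    IsPolymer b (X ∩ Y) := by
  intro x hx
  rw [mem_inter] at hx
  exact subset_inter (hX hx.1) (hY hx.2)

/-- Differences of polymers are polymers. [folklore] -/
theorem IsPolymer.sdiff {b : ℕ} {X Y : Finset (TorusSite d M)} (hX : IsPolymer b X) (hY : IsPolymer b Y) :
    IsPolymer b (X \ Y) := by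
  rw [sdiff_eq_inter_compl]
  exact hX.inter hY.compl

/-- The blocks comprising a set (`ℬ_j(X)` for a polymer `X`). [cite: Slade2017, §6.1 (the set ℬ_j(X))] -/
def blocksOf (b : ℕ) (X : Finset (TorusSite d M)) : Finset (Finset (TorusSite d M)) := X.image (block b)

/-- `|X|_j`: the number of `j`-blocks in `X`. [cite: Slade2017, §6.2.3 ("|X|_j denotes the number of j-blocks that comprise X")] -/
def numBlocks (b : ℕ) (X : Finset (TorusSite d M)) : ℕ := (blocksOf b X).card

/-- A polymer is the union of its blocks. [folklore] -/
theorem IsPolymer.eq_biUnion {b : ℕ} {X : Finset (TorusSite d M)} (hX : IsPolymer b X) :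
    X = (blocksOf b X).biUnion id := by
  ext y
  simp only [blocksOf, mem_biUnion, mem_image, id_eq]
  constructor
  · intro hy; exact ⟨block b y, ⟨y, hy, rfl⟩, mem_block_self b y⟩
  · rintro ⟨_, ⟨x, hx, rfl⟩, hy⟩; exact hX hx hy

/-- A block consists of a single block: `|B|_j = 1`. [folklore] -/
theorem numBlocks_block (b : ℕ) (x : TorusSite d M) : numBlocks b (block b x) = 1 := by
  unfold numBlocks blocksOf
  rw [card_eq_one]
  refine ⟨block b x, ?_⟩
  ext B
  simp only [mem_image, mem_singleton]
  constructor
  · rintro ⟨y, hy, rfl⟩; exact block_eq_of_mem hy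
  · rintro rfl; exact ⟨x, mem_block_self b x, rfl⟩

/-! ### Sub-polymers and the circle product -/

open Classical in
/-- The polymers contained in `Y`. [folklore] -/
def subpolymers (b : ℕ) (Y : Finset (TorusSite d M)) : Finset (Finset (TorusSite d M)) :=
  Y.powerset.filter fun X => IsPolymer b X

/-- Membership in `subpolymers`. [folklore] -/
theorem mem_subpolymers {b : ℕ} {X Y : Finset (TorusSite d M)} :
    X ∈ subpolymers b Y ↔ X ⊆ Y ∧ IsPolymer b X := by
  classical
  simp [subpolymers]

/-- **The circle product** `(F_1 ∘ F_2)(Y) = Σ_{X ∈ 𝒫_j : X ⊆ Y} F_1(X) F_2(Y ∖ X)` of two polymer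
activities with values in a commutative ring (for the renormalisation group: the algebra `𝒩` of
functions of the field). "The terms corresponding to `X = ∅` and `X = Y` are included".
[cite: Slade2017, §6.1 (display defining the circle product)] -/
def circ {R : Type*} [CommSemiring R] (b : ℕ) (F G : Finset (TorusSite d M) → R)
    (Y : Finset (TorusSite d M)) : R :=
  ∑ X ∈ subpolymers b Y, F X * G (Y \ X)

/-- The identity `𝟙_∅(X) = 𝟙_{X = ∅}` of the circle product. [cite: Slade2017, §6.1 ("The identity element is 𝟙_∅")] -/
def unitP {R : Type*} [CommSemiring R] (X : Finset (TorusSite d M)) : R := if X = ∅ then 1 else 0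

/-- Complementation `X ↦ Y ∖ X` is an involution of the sub-polymers of a polymer `Y`. [folklore] -/
theorem sdiff_mem_subpolymers {b : ℕ} {X Y : Finset (TorusSite d M)} (hY : IsPolymer b Y)
    (hX : X ∈ subpolymers b Y) : Y \ X ∈ subpolymers b Y := by
  rw [mem_subpolymers] at hX ⊢
  exact ⟨sdiff_subset, hY.sdiff hX.2⟩

/-- **The circle product is commutative** (on polymers). [cite: Slade2017, §6.1 ("The circle product is associative and commutative")] -/
theorem circ_comm {R : Type*} [CommSemiring R] {b : ℕ} (F G : Finset (TorusSite d M) → R)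
    {Y : Finset (TorusSite d M)} (hY : IsPolymer b Y) : circ b F G Y = circ b G F Y := by
  unfold circ
  refine Finset.sum_nbij' (fun X => Y \ X) (fun X => Y \ X) (fun X hX => sdiff_mem_subpolymers hY hX)
    (fun X hX => sdiff_mem_subpolymers hY hX) (fun X hX => ?_) (fun X hX => ?_) (fun X hX => ?_)
  · rw [mem_subpolymers] at hX
    exact Finset.sdiff_sdiff_eq_self hX.1
  · rw [mem_subpolymers] at hX
    exact Finset.sdiff_sdiff_eq_self hX.1
  · rw [mem_subpolymers] at hX
    rw [Finset.sdiff_sdiff_eq_self hX.1, mul_comm]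

/-- **`𝟙_∅` is the identity**: `(F ∘ 𝟙_∅)(Y) = F(Y)`. [cite: Slade2017, §6.1 ("(F ∘ 𝟙_∅)(Y) = F(Y) for all F and Y")] -/
theorem circ_unitP {R : Type*} [CommSemiring R] {b : ℕ} (F : Finset (TorusSite d M) → R)
    {Y : Finset (TorusSite d M)} (hY : IsPolymer b Y) : circ b F unitP Y = F Y := by
  unfold circ
  rw [Finset.sum_eq_single Y]
  · simp [unitP]
  · intro X hX hXY
    rw [mem_subpolymers] at hX
    have : Y \ X ≠ ∅ := by
      intro h
      rw [sdiff_eq_empty_iff_subset] at h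
      exact hXY (subset_antisymm hX.1 h)
    simp [unitP, this]
  · intro h
    exact absurd (mem_subpolymers.2 ⟨subset_refl _, hY⟩) h

/-- `(𝟙_∅ ∘ F)(Y) = F(Y)`. [cite: Slade2017, §6.1] -/
theorem unitP_circ {R : Type*} [CommSemiring R] {b : ℕ} (F : Finset (TorusSite d M) → R)
    {Y : Finset (TorusSite d M)} (hY : IsPolymer b Y) : circ b unitP F Y = F Y := by
  rw [circ_comm _ _ hY, circ_unitP F hY]

/-- **The circle product is associative** (on polymers): both iterated products equal the sum
over pairs of disjoint sub-polymers. [cite: Slade2017, §6.1 ("The circle product is associative and commutative")] -/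
theorem circ_assoc {R : Type*} [CommSemiring R] {b : ℕ} (F G H : Finset (TorusSite d M) → R)
    (Y : Finset (TorusSite d M)) :
    circ b (circ b F G) H Y = circ b F (circ b G H) Y := by
  unfold circ
  simp only [Finset.sum_mul, Finset.mul_sum]
  -- LHS: Σ_{X ⊆ Y} Σ_{W ⊆ X} F W G (X∖W) H (Y∖X); RHS: Σ_{W ⊆ Y} Σ_{V ⊆ Y∖W} F W G V H ((Y∖W)∖V)
  rw [Finset.sum_sigma', Finset.sum_sigma']
  refine Finset.sum_nbij' (fun p => ⟨p.2, p.1 \ p.2⟩) (fun q => ⟨q.1 ∪ q.2, q.1⟩) ?_ ?_ ?_ ?_ ?_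
  · rintro ⟨X, W⟩ h
    simp only [mem_sigma, mem_subpolymers] at h ⊢
    obtain ⟨⟨hXY, hXp⟩, hWX, hWp⟩ := h
    exact ⟨⟨hWX.trans hXY, hWp⟩, sdiff_subset_sdiff hXY (subset_refl W), hXp.sdiff hWp⟩
  · rintro ⟨W, V⟩ h
    simp only [mem_sigma, mem_subpolymers] at h ⊢
    obtain ⟨⟨hWY, hWp⟩, hV, hVp⟩ := h
    refine ⟨⟨union_subset hWY (hV.trans sdiff_subset), hWp.union hVp⟩, subset_union_left, hWp⟩
  · rintro ⟨X, W⟩ h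
    simp only [mem_sigma, mem_subpolymers] at h
    obtain ⟨⟨_, _⟩, hWX, _⟩ := h
    simp [union_sdiff_of_subset hWX]
  · rintro ⟨W, V⟩ h
    simp only [mem_sigma, mem_subpolymers] at h
    obtain ⟨⟨_, _⟩, hV, _⟩ := h
    have hdisj : Disjoint W V := disjoint_of_subset_right hV disjoint_sdiff
    simp [union_sdiff_left, sdiff_eq_self_of_disjoint hdisj.symm]
  · rintro ⟨X, W⟩ h
    simp only [mem_sigma, mem_subpolymers] at h
    obtain ⟨⟨hXY, _⟩, hWX, _⟩ := h
    have e : (Y \ W) \ (X \ W) = Y \ X := by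
      ext z
      simp only [mem_sdiff, not_and, not_not]
      constructor
      · rintro ⟨⟨hzY, hzW⟩, h⟩
        exact ⟨hzY, fun hzX => hzW (h hzX)⟩
      · rintro ⟨hzY, hzX⟩
        exact ⟨⟨hzY, fun hzW => hzX (hWX hzW)⟩, fun hzX' => absurd hzX' hzX⟩
    simp only [e, mul_assoc]

/-! ### Blocks are connected; components of polymers are polymers -/

/-- One step up in coordinate `i` inside a block: if `x, y ∈ B` with `x_i < y_i` (as
representatives), then `x + e_i ∈ B` and `|x + e_i - x|_∞ = 1`. [folklore] -/
theorem step_mem_block {b : ℕ} {x y : TorusSite d M} (hy : y ∈ block b x) (i : Fin d)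
    (hlt : (x i).val < (y i).val) :
    Function.update x i (x i + 1) ∈ block b x ∧ AdjInf x (Function.update x i (x i + 1)) ∧
      (Function.update x i (x i + 1) i).val = (x i).val + 1 := by
  have hM : (y i).val < M := ZMod.val_lt _
  haveI : Fact (1 < M) := ⟨by omega⟩
  have hval : (x i + 1).val = (x i).val + 1 := by
    rw [ZMod.val_add, ZMod.val_one, Nat.mod_eq_of_lt (by omega)]
  rw [mem_block] at hy
  refine ⟨?_, ?_, by simp [hval]⟩
  · rw [mem_block]
    funext i'
    by_cases hi : i' = i
    · subst hi
      simp only [blockKey, Function.update_self, hval]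
      have h1 : (x i').val / b ≤ ((x i').val + 1) / b := Nat.div_le_div_right (Nat.le_succ _)
      have h2 : ((x i').val + 1) / b ≤ (y i').val / b := Nat.div_le_div_right hlt
      have h3 : (y i').val / b = (x i').val / b := congrFun hy i'
      omega
    · simp [blockKey, Function.update_of_ne hi]
  · refine ⟨fun h => ?_, fun i' => ?_⟩
    · have := congrFun h i
      simp only [Function.update_self] at this
      have h0 : (1 : ZMod M) = 0 := by
        have := congrArg (fun t => t - x i) this
        simpa using this.symm
      exact absurd (congrArg ZMod.val h0) (by rw [ZMod.val_one, ZMod.val_zero]; omega)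
    · by_cases hi : i' = i
      · subst hi; exact Or.inr (Or.inl (by simp))
      · exact Or.inl (by simp [Function.update_of_ne hi])

/-- **Blocks are connected**: any two points of a block are joined inside it. [folklore] -/
theorem connIn_block {b : ℕ} {x y : TorusSite d M} (hy : y ∈ block b x) : ConnIn (block b x) x y := by
  -- induction on the `ℓ¹` distance of the representatives
  suffices H : ∀ (D : ℕ) (x y : TorusSite d M), y ∈ block b x →
      ∑ i, ((x i).val + (y i).val - 2 * min (x i).val (y i).val) = D → ConnIn (block b x) x y from
    H _ x y hy rfl
  intro D
  induction D using Nat.strong_induction_on with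
  | _ D ih =>
    intro x y hy hD
    by_cases hxy : x = y
    · subst hxy; exact Relation.ReflTransGen.refl
    · -- a coordinate where the representatives differ
      obtain ⟨i, hi⟩ : ∃ i, (x i).val ≠ (y i).val := by
        by_contra h
        push Not at h
        exact hxy (funext fun i => ZMod.val_injective _ (h i))
      rcases Nat.lt_or_gt_of_ne hi with hlt | hgt
      · -- move `x` up
        obtain ⟨hx'B, hadj, hval⟩ := step_mem_block hy i hlt
        set x' := Function.update x i (x i + 1) with hx'
        have hBB : block b x' = block b x := block_eq_of_mem hx'B
        have hyB' : y ∈ block b x' := by rw [hBB]; exact hy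
        have hstep : ConnIn (block b x) x x' :=
          Relation.ReflTransGen.single ⟨mem_block_self b x, hx'B, hadj⟩
        have hdec : ∑ i, ((x' i).val + (y i).val - 2 * min (x' i).val (y i).val) < D := by
          rw [← hD]
          apply Finset.sum_lt_sum
          · intro i' _
            by_cases hii : i' = i
            · subst hii; rw [hval]; omega
            · simp [hx', Function.update_of_ne hii]
          · exact ⟨i, mem_univ i, by rw [hval]; omega⟩
        have := ih _ hdec x' y hyB' rfl
        rw [hBB] at this
        exact hstep.trans this
      · -- move `y` up (and use symmetry)
        have hx : x ∈ block b y := by rw [block_eq_of_mem hy]; exact mem_block_self b x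
        obtain ⟨hy'B, hadj, hval⟩ := step_mem_block hx i hgt
        set y' := Function.update y i (y i + 1) with hy'
        have hBy : block b y = block b x := block_eq_of_mem hy
        have hy'Bx : y' ∈ block b x := by rw [← hBy]; exact hy'B
        have hstep : ConnIn (block b x) y y' := by
          refine Relation.ReflTransGen.single ⟨hy, hy'Bx, hadj⟩
        have hdec : ∑ i, ((x i).val + (y' i).val - 2 * min (x i).val (y' i).val) < D := by
          rw [← hD]
          apply Finset.sum_lt_sum
          · intro i' _
            by_cases hii : i' = i
            · subst hii; rw [hval]; omega
            · simp [hy', Function.update_of_ne hii]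
          · exact ⟨i, mem_univ i, by rw [hval]; omega⟩
        have := ih _ hdec x y' hy'Bx rfl
        exact this.trans hstep.symm

/-- Blocks are connected sets. [folklore] -/
theorem isConn_block (b : ℕ) (x : TorusSite d M) : IsConn (block b x) := by
  refine ⟨⟨x, mem_block_self b x⟩, fun y hy z hz => ?_⟩
  have hyB : block b y = block b x := block_eq_of_mem hy
  have hz' : z ∈ block b y := by rw [hyB]; exact hz
  have := connIn_block hz'
  rwa [hyB] at this

/-- **The components of a polymer are polymers.** [folklore] -/
theorem IsPolymer.comp {b : ℕ} {X : Finset (TorusSite d M)} (hX : IsPolymer b X) (x : TorusSite d M) :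
    IsPolymer b (comp X x) := by
  intro y hy z hz
  obtain ⟨hyX, hxy⟩ := mem_comp.1 hy
  refine mem_comp.2 ⟨hX hyX hz, hxy.trans ?_⟩
  exact (connIn_block hz).mono (hX hyX)

/-- Components of a polymer, as members of `components`, are connected polymers. [folklore] -/
theorem IsPolymer.of_mem_components {b : ℕ} {X Y : Finset (TorusSite d M)} (hX : IsPolymer b X)
    (hY : Y ∈ components X) : IsPolymer b Y ∧ IsConn Y := by
  simp only [components, mem_image] at hY
  obtain ⟨x, hx, rfl⟩ := hY
  exact ⟨hX.comp x, isConn_comp hx⟩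

/-! ### Small sets and the small-set neighbourhood `X^□` -/

/-- A small set: a connected polymer of at most `2^d` blocks. [cite: Slade2017, §6.1 (definition of small sets)] -/
def IsSmall (b : ℕ) (X : Finset (TorusSite d M)) : Prop := IsPolymer b X ∧ IsConn X ∧ numBlocks b X ≤ 2 ^ d

/-- A block is a small set. [folklore] -/
theorem isSmall_block (b : ℕ) (x : TorusSite d M) : IsSmall b (block b x) :=
  ⟨isPolymer_block b x, isConn_block b x, by rw [numBlocks_block]; exact Nat.one_le_two_pow⟩

open Classical in
/-- The small-set neighbourhood `X^□ = ⋃ {Y ∈ 𝒮_j : X ∩ Y ≠ ∅}`. [cite: Slade2017, §6.1 (definition of X^□)] -/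
def sclosure (b : ℕ) (X : Finset (TorusSite d M)) : Finset (TorusSite d M) :=
  univ.filter fun y => ∃ Y : Finset (TorusSite d M), IsSmall b Y ∧ (X ∩ Y).Nonempty ∧ y ∈ Y

/-- Membership in `X^□`. [folklore] -/
theorem mem_sclosure {b : ℕ} {X : Finset (TorusSite d M)} {y : TorusSite d M} :
    y ∈ sclosure b X ↔ ∃ Y : Finset (TorusSite d M), IsSmall b Y ∧ (X ∩ Y).Nonempty ∧ y ∈ Y := by
  classical
  simp [sclosure]

/-- `X ⊆ X^□`. [cite: BrydgesSlade2015RGI, §3.7 (after Definition 3.7.1: "X ⊂ X^□")] -/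
theorem subset_sclosure (b : ℕ) (X : Finset (TorusSite d M)) : X ⊆ sclosure b X := fun x hx =>
  mem_sclosure.2 ⟨block b x, isSmall_block b x, ⟨x, mem_inter.2 ⟨hx, mem_block_self b x⟩⟩,
    mem_block_self b x⟩

/-- `(X ∪ Y)^□ = X^□ ∪ Y^□`. [cite: BrydgesSlade2015RGI, §3.7 (after Definition 3.7.1: "(X ∪ Y)^□ = X^□ ∪ Y^□")] -/
theorem sclosure_union (b : ℕ) (X Y : Finset (TorusSite d M)) :
    sclosure b (X ∪ Y) = sclosure b X ∪ sclosure b Y := by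
  ext z
  simp only [mem_union, mem_sclosure]
  constructor
  · rintro ⟨W, hW, ⟨w, hw⟩, hzW⟩
    rw [mem_inter, mem_union] at hw
    rcases hw.1 with h | h
    · exact Or.inl ⟨W, hW, ⟨w, mem_inter.2 ⟨h, hw.2⟩⟩, hzW⟩
    · exact Or.inr ⟨W, hW, ⟨w, mem_inter.2 ⟨h, hw.2⟩⟩, hzW⟩
  · rintro (⟨W, hW, ⟨w, hw⟩, hzW⟩ | ⟨W, hW, ⟨w, hw⟩, hzW⟩)
    · exact ⟨W, hW, ⟨w, mem_inter.2 ⟨mem_union_left _ (mem_inter.1 hw).1, (mem_inter.1 hw).2⟩⟩, hzW⟩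
    · exact ⟨W, hW, ⟨w, mem_inter.2 ⟨mem_union_right _ (mem_inter.1 hw).1, (mem_inter.1 hw).2⟩⟩, hzW⟩

/-- `X^□` is a polymer. [folklore] -/
theorem isPolymer_sclosure (b : ℕ) (X : Finset (TorusSite d M)) : IsPolymer b (sclosure b X) := by
  intro y hy z hz
  obtain ⟨Y, hY, hXY, hyY⟩ := mem_sclosure.1 hy
  exact mem_sclosure.2 ⟨Y, hY, hXY, hY.1 hyY hz⟩

/-- `X^□` is monotone. [folklore] -/
theorem sclosure_mono (b : ℕ) {X X' : Finset (TorusSite d M)} (h : X ⊆ X') : sclosure b X ⊆ sclosure b X' := by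
  intro y hy
  obtain ⟨Y, hY, ⟨w, hw⟩, hyY⟩ := mem_sclosure.1 hy
  exact mem_sclosure.2 ⟨Y, hY, ⟨w, mem_inter.2 ⟨h (mem_inter.1 hw).1, (mem_inter.1 hw).2⟩⟩, hyY⟩

/-! ### The last scale: one block -/

/-- When the block side reaches the period, every block is the whole torus ("The unique
`N`-block is `Λ_N` itself"). [cite: Slade2017, §6.1] -/
theorem block_eq_univ_of_le {b : ℕ} (hb : M ≤ b) (x : TorusSite d M) : block b x = univ := by
  ext y
  simp only [mem_block, mem_univ, iff_true]
  funext i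
  simp only [blockKey]
  rw [Nat.div_eq_of_lt ((ZMod.val_lt _).trans_le hb), Nat.div_eq_of_lt ((ZMod.val_lt _).trans_le hb)]

/-- At the last scale the only polymers are `∅` and `Λ` ("the only polymers at scale `N` are
`∅, Λ`", proof of Proposition 8.2.2). [cite: Slade2017, §8.2 (proof of Proposition 8.2.2, first sentence)] -/
theorem isPolymer_iff_of_le {b : ℕ} (hb : M ≤ b) (X : Finset (TorusSite d M)) :
    IsPolymer b X ↔ X = ∅ ∨ X = univ := by
  constructor
  · intro hX
    rcases X.eq_empty_or_nonempty with h | ⟨x, hx⟩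
    · exact Or.inl h
    · right
      exact eq_univ_of_forall fun y => hX hx (by rw [block_eq_univ_of_le hb]; exact mem_univ y)
  · rintro (rfl | rfl)
    · exact isPolymer_empty b
    · exact isPolymer_univ b

/-- At the last scale, `(F ∘ G)(Λ) = F(Λ) + G(Λ)` for activities with `F(∅) = G(∅) = 1`
(so `Z_N = e^{-u_N|Λ|}(I_N(Λ) + K_N(Λ))`). [cite: Slade2017, §8.2 (proof of Proposition 8.2.2: Z_N(Λ) = e^{-u_N|Λ|}(I_N(Λ)+K_N(Λ)))] -/
theorem circ_univ_of_le {R : Type*} [CommSemiring R] {b : ℕ} (hb : M ≤ b)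
    (F G : Finset (TorusSite d M) → R) (hF : F ∅ = 1) (hG : G ∅ = 1) :
    circ b F G univ = F univ + G univ := by
  have hne : (univ : Finset (TorusSite d M)) ≠ ∅ := univ_nonempty.ne_empty
  have hsub : subpolymers b (univ : Finset (TorusSite d M)) = {∅, univ} := by
    ext X
    rw [mem_subpolymers, isPolymer_iff_of_le hb, mem_insert, mem_singleton]
    simp
  unfold circ
  rw [hsub, sum_insert (by simp [Ne.symm hne]), sum_singleton, sdiff_empty, sdiff_self, hF,
    Finset.bot_eq_empty, hG, one_mul, mul_one, add_comm]

/-! ### The space `𝒦_j` (Definition 6.1.2, `n ≥ 1`) -/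

/-- A scale-`j` automorphism of the torus: a bijection preserving nearest neighbours (both
ways) and mapping `j`-blocks onto `j`-blocks ("an automorphism of `Λ` means a bijective map from
`Λ` to `Λ` under which nearest-neighbour points are mapped to nearest-neighbour points under both
the map and its inverse"). [cite: BrydgesSlade2015RGI, §1.4 of the companion [BS-rg-loc] (automorphisms 𝓔(Λ))] [cite: Slade2017, Definition 6.1.2 (Euclidean covariance)] -/
def IsScaleAut (b : ℕ) (E : TorusSite d M ≃ TorusSite d M) : Prop :=
  (∀ x y, (torusGraph d M).Adj x y ↔ (torusGraph d M).Adj (E x) (E y)) ∧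
    ∀ x, (block b x).map E.toEmbedding = block b (E x)

/-- **Slade, Definition 6.1.2 (the space `𝒦_j`, case `n ≥ 1`)**: a polymer activity
`K : 𝒫_j → 𝒩` (given here by its values on all finite subsets, used on polymers), with
`K(∅) = 1`, and the properties: field locality `K(X) ∈ 𝒩(X^□)`; symmetry — Euclidean covariance
`E(K(X)) = K(EX)` with `(EF)(φ) = F(φ_E)`, `(φ_E)_x = φ_{Ex}`, and `O(n)` invariance; component
factorisation `K(X) = ∏_{Y ∈ Comp_j(X)} K(Y)`. (The linear structure of `𝒦_j` lives on the values
on connected polymers, from which `K` is recovered by factorisation; supersymmetry concerns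
`n = 0` only.) [cite: Slade2017, Definition 6.1.2] -/
structure KSpace (b n : ℕ) where
  /-- the activity `X ↦ K(X)`, a function of the field `φ : Λ → ℝⁿ` -/
  K : Finset (TorusSite d M) → (TorusSite d M → Fin n → ℝ) → ℝ
  /-- `K(∅) = 1` -/
  map_empty : K ∅ = fun _ => 1
  /-- field locality: `K(X) ∈ 𝒩(X^□)` -/
  fieldLocality : ∀ X, IsPolymer b X → DependsOn (sclosure b X) (K X)
  /-- component factorisation -/
  factorisation : ∀ X, IsPolymer b X → K X = fun φ => ∏ Y ∈ components X, K Y φ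
  /-- `O(n)` invariance -/
  on_invariant : ∀ X (R : Matrix (Fin n) (Fin n) ℝ), R ∈ Matrix.orthogonalGroup (Fin n) ℝ →
    ∀ φ, K X (fun x => R.mulVec (φ x)) = K X φ
  /-- Euclidean covariance under scale-`j` automorphisms -/
  euclid_covariant : ∀ E : TorusSite d M ≃ TorusSite d M, IsScaleAut b E →
    ∀ X φ, K (X.map E.toEmbedding) φ = K X (φ ∘ E)

/-- The identity `𝟙_∅` is an element of `𝒦_j` (`K_0 = 𝟙_∅`, the initial condition).
[cite: Slade2017, §6.1 ("Let K_0 : 𝒫_0 → 𝒩 be the identity element K_0 = 𝟙_∅")] -/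
def KSpace.unit (b n : ℕ) : KSpace (d := d) (M := M) b n where
  K := fun X _ => if X = ∅ then 1 else 0
  map_empty := by funext φ; simp
  fieldLocality := fun X _ φ ψ _ => rfl
  factorisation := by
    intro X hX
    funext φ
    rcases X.eq_empty_or_nonempty with rfl | hne
    · simp [components]
    · rw [if_neg hne.ne_empty]
      obtain ⟨x, hx⟩ := hne
      symm
      apply Finset.prod_eq_zero (i := comp X x) (mem_image_of_mem _ hx)
      rw [if_neg (nonempty_iff_ne_empty.1 ⟨x, mem_comp_self hx⟩)]
  on_invariant := fun _ _ _ _ => rfl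
  euclid_covariant := by
    intro E _ X φ
    simp only [Finset.map_eq_empty]

end Polymer

end LongRangePhi4

end Literature.Barriers.CriticalPhenomena

end
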